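import Mathlib.Analysis.Complex.Basic
import Mathlib.Algebra.MvPolynomial.Rename
import Literature.Computability.Complexity.NullstellensatzRefutation
import HarnessLib

/-!
# Hermitian sums-of-squares (Positivstellensatz) refutations of complex polynomial systems

Definition request `defn-HasHermitianSosRefutationOfDegree` (route ValiantsHypothesis/
RefutationDegree: items CertWindowQP, RefutationBarrier, BeyondHessianSos, SosSound, NsToSos inline
exactly this notion for the determinantal-representability system `Rep(n, m)`), filed next to the
accepted `HasNSRefutationOfDegree` (`NullstellensatzRefutation.lean`, same directory and namespace;
kept in a separate file so that the NS vocabulary stays free of the `ℂ` import).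

## The notion

A **sum-of-squares (Positivstellensatz) refutation** of a REAL system `{f_i = 0}` is an identity
`g + ∑ h_i f_i = -1` with `g` a sum of squares; its **degree** is `max_i deg(h_i f_i)` together
with the degree of the SOS part (Krajíček, *Proof Complexity*, §6.4, Cor. 6.4.4, (6.4.4) and the
degree of a Positivstellensatz refutation, (6.4.6); Grigoriev–Vorobjov 2001 / Grigoriev 2001 for
degree lower bounds). For a COMPLEX system `{g_i(x) = 0}`, `g_i ∈ ℂ[σ]`, unsolvability over `ℂ`
is unsolvability over `ℝ` of the realified system `{Re g_i = Im g_i = 0}` in the real coordinates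
`x = u + iv`, and a real Positivstellensatz refutation of the realification is most conveniently
written in **Hermitian coordinates**: work in `ℂ[σ ⊕ σ]` (a holomorphic copy `inl` and an
anti-holomorphic copy `inr` of each variable), let `cj` = "conjugate the coefficients and swap the
two copies" (`hermConj`, a ring involution whose fixed points are the real polynomials in `u, v`),
and ask for

  `∑_j q_j · cj(q_j) + ∑_i (h_i · g_i + cj(h_i · g_i)) + 1 = 0`   in `ℂ[σ ⊕ σ]`,

`g_i` lifted to the holomorphic copy (`rename Sum.inl`). Under `x = u + iv`: `q · cj(q) =
(Re q)² + (Im q)²` is a sum of two real squares and every real square `r²` is `r · cj(r)`;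
`h g + cj(h g) = a Re g + b Im g` with `h = (a - ib)/2`; degrees in `(z, z̄)` and in `(u, v)` agree.
So `HasHermitianSosRefutationOfDegree g d` below is exactly "the realification of `{g_i = 0}` has
a Positivstellensatz (SOS) refutation in which every product has degree `≤ d`" (the route's
convention: ALL products `q_j cj(q_j)` and `h_i g_i` of total degree `≤ d`). This dictionary is
the justification of the name and is recorded here, not formalised (the route asked for it only
optionally); what IS proved is what the route uses: SOUNDNESS (a refutation excludes common complex
zeros — evaluate at `(x, x̄)`) and NS ⇒ SOS with the same degree.

## Contents (all definitions real, all lemmas proved; no named facts)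

* `hermConj : ℂ[σ ⊕ σ] →+* ℂ[σ ⊕ σ]`, `hermConj p = rename Sum.swap (map conj p)` (`rfl`), an
  involution (`hermConj_hermConj`), `hermConj (C c) = C (conj c)`, and the evaluation rule
  `eval (x, x̄) (hermConj p) = conj (eval (x, x̄) p)` (`eval_conjPoint_hermConj`).
* `HasHermitianSosRefutationOfDegree g d` — the definition (shape parallel to
  `HasNSRefutationOfDegree`: a finite set `s` of axioms used, `k` squares).
* `HasHermitianSosRefutationOfDegree.mono`, `hasHermitianSosRefutationOfDegree_iff_forall`
  (`Fintype`-indexed "`∀ i`" form, the shape the route inlines with `s = P.support`).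
* `HasHermitianSosRefutationOfDegree.no_commonZero` — SOUNDNESS.
* `HasNSRefutationOfDegree.hasHermitianSosRefutationOfDegree` — NS degree `d` ⇒ Hermitian SOS
  degree `d` (`k = 0`, `h' = -½ · lift h`).

Mathlib: `MvPolynomial.rename`, `MvPolynomial.map`, `starRingEnd ℂ`, `eval_rename`, `eval_map`,
`eval₂_comp_left`, `totalDegree_mul`, `totalDegree_rename_le`, `Complex.mul_conj`,
`Complex.normSq_nonneg`; Mathlib has no proof-complexity vocabulary (searched `Positivstellensatz`,
`SumOfSquares` — only `Mathlib.Algebra.Polynomial.SumOfSquares`-style `IsSumSq` for semirings,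
not refutations).

## References

* J. Krajíček, *Proof Complexity*, CUP 2019, §6.4: Thm 6.4.3 (Positivstellensatz), Cor. 6.4.4 and
  (6.4.4) (SOS-proofs of `{f_i = 0}`), (6.4.6) and the following display (degree).
  [KrajicekProofComplexity2019]
* D. Grigoriev, *Complexity of Positivstellensatz proofs for the knapsack*, Comput. Complexity 10
  (2001) 139–154 (degree of Positivstellensatz calculus refutations). [Grigoriev2001]
-/

noncomputable section

open MvPolynomial Finset
open scoped ComplexConjugate

namespace Literature.Computability.Complexity

section Hermitian

variable {ι σ : Type*}

/-! ### Hermitian conjugation on `ℂ[σ ⊕ σ]` -/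

/-- **Hermitian conjugation** `cj` on `ℂ[σ ⊕ σ]`: conjugate the coefficients and swap the
holomorphic (`inl`) and anti-holomorphic (`inr`) copies of the variables,
`cj p = rename Sum.swap (map conj p)` — a ring homomorphism (indeed an involution). Its fixed
points are the real polynomials in the real coordinates `u = (z + z̄)/2`, `v = (z - z̄)/2i`
(standard Hermitian bookkeeping; the object the route calls `cj`). [folklore] -/
def hermConj : MvPolynomial (σ ⊕ σ) ℂ →+* MvPolynomial (σ ⊕ σ) ℂ :=
  (rename (R := ℂ) (Sum.swap : σ ⊕ σ → σ ⊕ σ)).toRingHom.comp (map (starRingEnd ℂ))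

/-- `cj p = rename Sum.swap (map conj p)` — the form the route inlines (definitional). [folklore] -/
theorem hermConj_apply (p : MvPolynomial (σ ⊕ σ) ℂ) :
    hermConj p = rename Sum.swap (map (starRingEnd ℂ) p) := rfl

/-- `cj` on constants conjugates: `cj (C c) = C (conj c)`. [folklore] -/
@[simp] theorem hermConj_C (c : ℂ) : hermConj (C c : MvPolynomial (σ ⊕ σ) ℂ) = C (conj c) := by
  rw [hermConj_apply, map_C, rename_C]

/-- `cj` swaps the two copies of a variable: `cj (X v) = X (swap v)`. [folklore] -/
@[simp] theorem hermConj_X (v : σ ⊕ σ) : hermConj (X v : MvPolynomial (σ ⊕ σ) ℂ) = X v.swap := by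
  rw [hermConj_apply, map_X, rename_X]

/-- `cj` is an involution. [folklore] -/
theorem hermConj_hermConj (p : MvPolynomial (σ ⊕ σ) ℂ) : hermConj (hermConj p) = p := by
  induction p using MvPolynomial.induction_on with
  | C c => simp
  | add p q hp hq => rw [map_add, map_add, hp, hq]
  | mul_X p v hp => rw [map_mul, map_mul, hp, hermConj_X, hermConj_X, Sum.swap_swap]

/-- The **conjugate point** `(x, x̄) : σ ⊕ σ → ℂ` at which Hermitian identities are evaluated. [folklore] -/
def conjPoint (x : σ → ℂ) : σ ⊕ σ → ℂ :=
  Sum.elim x (star ∘ x)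

/-- The holomorphic coordinates of the conjugate point are `x`. [folklore] -/
@[simp] theorem conjPoint_inl (x : σ → ℂ) (a : σ) : conjPoint x (Sum.inl a) = x a := rfl

/-- The anti-holomorphic coordinates of the conjugate point are `x̄`. [folklore] -/
@[simp] theorem conjPoint_inr (x : σ → ℂ) (a : σ) : conjPoint x (Sum.inr a) = conj (x a) := rfl

/-- Swapping the copies of the conjugate point conjugates it. [folklore] -/
theorem conjPoint_comp_swap (x : σ → ℂ) :
    conjPoint x ∘ Sum.swap = starRingEnd ℂ ∘ conjPoint x := by
  funext v
  rcases v with a | a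
  · simp [conjPoint]
  · simp [conjPoint]

/-- **Evaluation rule**: at the conjugate point, `cj p` evaluates to the conjugate of the value of
`p`: `eval (x, x̄) (cj p) = conj (eval (x, x̄) p)`. [folklore] -/
theorem eval_conjPoint_hermConj (x : σ → ℂ) (p : MvPolynomial (σ ⊕ σ) ℂ) :
    eval (conjPoint x) (hermConj p) = conj (eval (conjPoint x) p) := by
  rw [hermConj_apply, eval_rename, conjPoint_comp_swap, eval_map]
  change eval₂ (starRingEnd ℂ) (starRingEnd ℂ ∘ conjPoint x) p =
    starRingEnd ℂ (eval₂ (RingHom.id ℂ) (conjPoint x) p)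
  rw [eval₂_comp_left (starRingEnd ℂ) (RingHom.id ℂ) (conjPoint x) p, RingHom.comp_id]

/-- At the conjugate point the holomorphic lift of `g` evaluates to `g(x)`. [folklore] -/
theorem eval_conjPoint_rename_inl (x : σ → ℂ) (g : MvPolynomial σ ℂ) :
    eval (conjPoint x) (rename Sum.inl g) = eval x g := by
  rw [eval_rename]
  rfl

/-- A Hermitian square `q · cj(q)` evaluates at the conjugate point to `|q(x, x̄)|² ≥ 0`. [folklore] -/
theorem eval_conjPoint_mul_hermConj (x : σ → ℂ) (q : MvPolynomial (σ ⊕ σ) ℂ) :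
    eval (conjPoint x) (q * hermConj q) = (Complex.normSq (eval (conjPoint x) q) : ℂ) := by
  rw [map_mul, eval_conjPoint_hermConj, Complex.mul_conj]

/-! ### Hermitian SOS refutations and their degree -/

/-- **Hermitian sums-of-squares (Positivstellensatz) refutation of degree `≤ d`** of the complex
polynomial system `{g i = 0}_i`, `g i ∈ ℂ[σ]`: finitely many axioms `s`, Hermitian squares
`q_j · cj(q_j)` (`j < k`) and multipliers `h i ∈ ℂ[σ ⊕ σ]` with
`∑_j q_j cj(q_j) + ∑_{i ∈ s} (h i · g i + cj(h i · g i)) + 1 = 0` in `ℂ[σ ⊕ σ]` (the `g i` lifted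
to the holomorphic copy of the variables), every product `q_j cj(q_j)` and `h i · g i` having
total degree `≤ d`. Via `x = u + iv` this is a real SOS-proof `g + ∑ (a_i Re g_i + b_i Im g_i)
= -1`, `g ∈ SOS`, of the realified system, of the same degree (Krajíček §6.4, (6.4.4); degree as
after (6.4.6)) — module docstring. [cite: KrajicekProofComplexity2019, §6.4 Cor. 6.4.4 (6.4.4) and degree after (6.4.6)] -/
def HasHermitianSosRefutationOfDegree (g : ι → MvPolynomial σ ℂ) (d : ℕ) : Prop :=
  ∃ (s : Finset ι) (k : ℕ) (q : Fin k → MvPolynomial (σ ⊕ σ) ℂ) (h : ι → MvPolynomial (σ ⊕ σ) ℂ),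
    (∀ j, (q j * hermConj (q j)).totalDegree ≤ d) ∧
    (∀ i ∈ s, (h i * rename Sum.inl (g i)).totalDegree ≤ d) ∧
    ∑ j, q j * hermConj (q j) +
      ∑ i ∈ s, (h i * rename Sum.inl (g i) + hermConj (h i * rename Sum.inl (g i))) + 1 = 0

variable {g : ι → MvPolynomial σ ℂ} {d d' : ℕ}

/-- Degree bounds are monotone. [folklore] -/
theorem HasHermitianSosRefutationOfDegree.mono (H : HasHermitianSosRefutationOfDegree g d)
    (hd : d ≤ d') : HasHermitianSosRefutationOfDegree g d' := by
  obtain ⟨s, k, q, h, hq, hh, hsum⟩ := H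
  exact ⟨s, k, q, h, fun j => (hq j).trans hd, fun i hi => (hh i hi).trans hd, hsum⟩

/-- For a finitely indexed system, the "`∀ i`" form with all axioms in play (extend the
multipliers by `0`) — the shape the route inlines (`s = P.support`, degree bound for every `μ`). [folklore] -/
theorem hasHermitianSosRefutationOfDegree_iff_forall [Fintype ι] (g : ι → MvPolynomial σ ℂ)
    (d : ℕ) :
    HasHermitianSosRefutationOfDegree g d ↔
      ∃ (k : ℕ) (q : Fin k → MvPolynomial (σ ⊕ σ) ℂ) (h : ι → MvPolynomial (σ ⊕ σ) ℂ),
        (∀ j, (q j * hermConj (q j)).totalDegree ≤ d) ∧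
        (∀ i, (h i * rename Sum.inl (g i)).totalDegree ≤ d) ∧
        ∑ j, q j * hermConj (q j) +
          ∑ i, (h i * rename Sum.inl (g i) + hermConj (h i * rename Sum.inl (g i))) + 1 = 0 := by
  classical
  constructor
  · rintro ⟨s, k, q, h, hq, hh, hsum⟩
    refine ⟨k, q, fun i => if i ∈ s then h i else 0, hq, fun i => ?_, ?_⟩
    · by_cases hi : i ∈ s
      · show ((if i ∈ s then h i else 0) * rename Sum.inl (g i)).totalDegree ≤ d
        rw [if_pos hi]; exact hh i hi
      · show ((if i ∈ s then h i else 0) * rename Sum.inl (g i)).totalDegree ≤ d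
        rw [if_neg hi, zero_mul, totalDegree_zero]; exact Nat.zero_le _
    · have hS : ∑ i, ((if i ∈ s then h i else 0) * rename Sum.inl (g i) +
          hermConj ((if i ∈ s then h i else 0) * rename Sum.inl (g i))) =
          ∑ i ∈ s, (h i * rename Sum.inl (g i) + hermConj (h i * rename Sum.inl (g i))) := by
        rw [← Finset.sum_subset (Finset.subset_univ s)]
        · exact Finset.sum_congr rfl fun i hi => by rw [if_pos hi]
        · intro i _ hi
          rw [if_neg hi, zero_mul, map_zero, add_zero]
      rw [hS]
      exact hsum
  · rintro ⟨k, q, h, hq, hh, hsum⟩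
    exact ⟨Finset.univ, k, q, h, hq, fun i _ => hh i, hsum⟩

/-- **Soundness of Hermitian SOS refutations.** If `{g i = 0}` has a Hermitian SOS refutation (of
any degree) then the `g i` have no common complex zero: evaluating the identity at the conjugate
point `(x, x̄)` of a common zero `x` gives `∑_j |q_j(x, x̄)|² + 0 + 1 = 0` in `ℂ`, absurd
(Krajíček §6.4, the easy direction of Thm 6.4.3 / Cor. 6.4.4). [cite: KrajicekProofComplexity2019, §6.4 Thm 6.4.3 (soundness direction)] -/
theorem HasHermitianSosRefutationOfDegree.no_commonZero (H : HasHermitianSosRefutationOfDegree g d)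
    (x : σ → ℂ) : ¬ ∀ i, eval x (g i) = 0 := by
  intro hx
  obtain ⟨s, k, q, h, -, -, hsum⟩ := H
  have hev := congrArg (eval (conjPoint x)) hsum
  simp only [map_add, map_sum, map_one, map_zero, map_mul, eval_conjPoint_hermConj,
    eval_conjPoint_rename_inl, hx, mul_zero, map_zero, add_zero, Finset.sum_const_zero,
    Complex.mul_conj] at hev
  -- `hev : ∑ j, (normSq (q_j(x,x̄)) : ℂ) + 1 = 0`
  have hre := congrArg Complex.re hev
  rw [Complex.add_re, Complex.re_sum, Complex.one_re, Complex.zero_re] at hre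
  simp only [Complex.ofReal_re] at hre
  have hnonneg : 0 ≤ ∑ j, Complex.normSq (eval (conjPoint x) (q j)) :=
    Finset.sum_nonneg fun j _ => Complex.normSq_nonneg _
  linarith

/-- In particular a system with a Hermitian SOS refutation has no solution. [folklore] -/
theorem HasHermitianSosRefutationOfDegree.not_exists_commonZero
    (H : HasHermitianSosRefutationOfDegree g d) : ¬ ∃ x : σ → ℂ, ∀ i, eval x (g i) = 0 :=
  fun ⟨x, hx⟩ => H.no_commonZero x hx

/-- **Nullstellensatz ⇒ Hermitian SOS, same degree.** A Nullstellensatz refutation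
`∑ h i · g i = 1` of degree `≤ d` yields the Hermitian SOS refutation with no squares (`k = 0`)
and multipliers `h' i = -½ · h i` (lifted to the holomorphic copy):
`∑ (h' i g i + cj(h' i g i)) + 1 = -½ - ½ + 1 = 0`, `cj` being a ring map fixing the real
constant `-½`; degrees do not increase (`totalDegree_rename_le`). (Krajíček §6.4: "the
Positivstellensatz proof system is the NS version of the SAC calculus"; `D_SOS ≤ D_NS`.)
[cite: KrajicekProofComplexity2019, §6.4 after (6.4.6)] -/
theorem HasNSRefutationOfDegree.hasHermitianSosRefutationOfDegree
    (H : HasNSRefutationOfDegree g d) : HasHermitianSosRefutationOfDegree g d := by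
  obtain ⟨s, m, hsum, hdeg⟩ := H
  refine ⟨s, 0, Fin.elim0, fun i => C (-(1 / 2 : ℂ)) * rename Sum.inl (m i), fun j => j.elim0,
    fun i hi => ?_, ?_⟩
  · -- degree: `C(-½) · lift (m i) · lift (g i) = C(-½) · lift (m i g i)`
    rw [mul_assoc, ← map_mul]
    calc (C (-(1 / 2 : ℂ)) * rename Sum.inl (m i * g i)).totalDegree
        ≤ (C (-(1 / 2 : ℂ)) : MvPolynomial (σ ⊕ σ) ℂ).totalDegree +
            (rename Sum.inl (m i * g i)).totalDegree := totalDegree_mul _ _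
      _ ≤ 0 + (m i * g i).totalDegree := by
          gcongr
          · exact (totalDegree_C _).le
          · exact totalDegree_rename_le _ _
      _ ≤ d := by rw [zero_add]; exact hdeg i hi
  · -- the identity
    have hlift : ∑ i ∈ s, C (-(1 / 2 : ℂ)) * rename Sum.inl (m i) * rename Sum.inl (g i) =
        (C (-(1 / 2 : ℂ)) : MvPolynomial (σ ⊕ σ) ℂ) := by
      have : ∑ i ∈ s, C (-(1 / 2 : ℂ)) * rename Sum.inl (m i) * rename Sum.inl (g i) =
          C (-(1 / 2 : ℂ)) * rename (Sum.inl : σ → σ ⊕ σ) (∑ i ∈ s, m i * g i) := by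
        rw [map_sum, Finset.mul_sum]
        refine Finset.sum_congr rfl fun i _ => ?_
        rw [map_mul, mul_assoc]
      rw [this, hsum, map_one, mul_one]
    have hc : (starRingEnd ℂ) (-(1 / 2 : ℂ)) = -(1 / 2 : ℂ) := by
      rw [map_neg, map_div₀, map_one, map_ofNat]
    rw [Finset.sum_add_distrib, ← map_sum, hlift, hermConj_C, hc]
    simp only [Finset.univ_eq_empty, Finset.sum_empty, zero_add]
    rw [← C_add, ← C_1, ← C_add]
    norm_num

end Hermitian

end Literature.Computability.Complexity

end
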